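import Summits.Ventures.WeilGRH.KeyOneVectorPrinciple
import Literature.NumberTheory.LFunctions.WeilMarkovQuadraticChar
import Summits.RiemannHypothesis.RiemannHypothesis.Theorems.WeilFormatCWindowSesq
import Mathlib.NumberTheory.LegendreSymbol.ZModChar
import HarnessLib

/-!
# GRH arm (rh-explicit, venture WeilGRH): the key forms ARE Markov window forms — the position-space dictionary for keys

Cell `rh-explicit`, WEIL TRACK — GRH ARM.  `KeyPolytope.lean` defines the form of a key `(a, L, v)` on the
window with `N` visible integers SPECTRALLY, on test functions:
`E_{a,L,v,N}(g) = (1/2π)∫|ĝ(½+iτ)|² M_{a,L,v,N}(τ) dτ`.  The tree's twisted Markov decomposition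
(`Literature/…/WeilMarkovQuadraticChar.lean`: `Re Q_χ(g) = 𝓔^χ_b(g) − M^χ_b‖g‖₂²` for `supp g ⊆ [−b, b]`,
`q ≠ 1`) writes the character form in POSITION space through twisted increments
`D^ω_t(u) = ∫|u(x+t) − ω u(x)|²dx` — an expression that makes sense for every WINDOW FUNCTION (the
trigonometric sections of the arm's certificates, `TwistedWindowForm/Gram.lean`).  The character enters
`𝓔^χ_b`, `M^χ_b` only through its parity, `log q` and the visible values `χ(n)`; this file makes that
explicit:

* `keyDirichletEnergy a v b u = Σ_{log n < 2b} (Λ(n)/√n) D^{conj v(n)}_{log n}(u) + ∫₀^∞ ρ_a(t) D_t(u) dt`,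
  `keyMarkovConstant a L v b = Σ_{log n < 2b} (Λ(n)/√n)(1 + |v(n)|²) + 2∫₀^∞ killing_a + log 4π + γ − L`,
  `keyMarkovForm a L v b u = keyDirichletEnergy a v b u − keyMarkovConstant a L v b · ‖u‖₂²`
  — for `(a, L, v) = (a_χ, log q, χ)` these ARE `weilDirichletEnergyChar χ b`, `weilMarkovConstantChar χ b`
  (`…_eq_key`, by `rfl`), so `Re Q_χ(g) = keyMarkovForm a_χ (log q) χ b g` (`re_weilQuadraticChar_eq_keyMarkovForm`);
* **affinity** (`keyMarkovForm_eq_zero_key_sub_of_isWeilTest`): the `|v(n)|²` terms of the energy and of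
  the killing constant CANCEL, and by the kernel identity `ω k(t) + ω̄ k(−t) = (1 + |ω|²)‖g‖₂² − D^{ω̄}_t(g)`
  (`mul_weilConv_weilReflect_add_conj_mul_neg`, valid for EVERY `ω ∈ ℂ`)
  `keyMarkovForm a L v b g = keyMarkovForm a L 0 b g − Σ_{log n < 2b} (Λ(n)/√n)·2 Re(v(n) (g ⋆ g̃)(log n))`
  — the same linear part as the spectral affine law `weilFinitePrimeQuadraticKey_eq_zero_key_sub_spikes`;
* **THE DICTIONARY** (`keyMarkovForm_eq_weilFinitePrimeQuadraticKey`): for a test function `g` with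
  `supp g ⊆ [−t, t]`, `e^{2t} ≤ N + 1`, parity `a ≤ 1` and ANY `(L, v)`:
  `keyMarkovForm a L v t g = E_{a,L,v,N}(g)` — proved from the character case at ONE anchor character of
  each parity (`χ₀ mod 2`, `χ₄ mod 4`; tree: `Re Q_χ = E_{χ,N}` and `Re Q_χ = 𝓔^χ − M^χ‖·‖²`) plus
  affinity in `v` and in `L` on both sides, the only analytic input being `(g ⋆ g̃)(log n) = 0` for
  `log n ≥ 2t` (`sum_range_spikes_eq_sum_weilPrimeIndex`).

Hence every statement of the key files (`KeyPolytope`, `KeyParityTransfer`, `KeyFamilyAverage`,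
`KeyOneVectorPrinciple/Torus`, `KeyFamilyVariance`) can be read on the position side, where the forms
extend to window functions and finite sections; the affinity holds there as well
(`keyMarkovForm_eq_zero_key_sub_of_isWindowFunction`, from `weilTwistIncrement_conj_of_isWindowFunction`:
`D^{ω̄}_t(u) = (1 + |ω|²)‖u‖₂² − 2 Re(ω (u ⋆ ũ)(t))` for every window function `u` and every `ω ∈ ℂ`).
Not here: the key version of the sesquilinear form / Gram expansion of `TwistedWindowGram.lean`.
Everything is PROVED; four definitions (three forms + the anchor character `oddCharFour`); no named facts;
RH/GRH-free.

## References
* A. Weil, *Sur les "formules explicites" de la théorie des nombres premiers* (1952), (11) pp. 261–262.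
  [Weil1952FormulesExplicites]
* E. Bombieri, *Remarks on Weil's quadratic functional in the theory of prime numbers I*, Rend. Mat. Acc.
  Lincei (9) 11 (2000), Thm 2 (p. 193) (the explicit formula through increments). [Bombieri2000Weil]
* H. Yoshida, *On Hermitian forms attached to zeta functions*, Adv. Stud. Pure Math. 21 (1992), §2
  (support of `g ⋆ g̃`). [Yoshida1992]
-/

noncomputable section

open Complex Set MeasureTheory Filter
open scoped Real ArithmeticFunction.vonMangoldt ComplexConjugate

namespace Summit.Ventures.WeilGRH

open Literature.NumberTheory.LFunctions

variable {q : ℕ} {g : ℝ → ℂ}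

/-! ## Definitions -/

/-- The **twisted pure-jump Dirichlet form of the key** `(a, ·, v)` on the window `[−b, b]`:
`Σ_{log n < 2b} (Λ(n)/√n)·D^{conj v(n)}_{log n}(u) + ∫₀^∞ e^{(1/2−a)t}/(2 sinh t)·D_t(u) dt` — the character
form `weilDirichletEnergyChar χ b` with `(charParity χ, χ(n))` replaced by abstract `(a, v(n))`.
[cite: Weil1952FormulesExplicites, (11) pp. 261–262; Bombieri2000Weil, Thm 2 (p. 193)] -/
def keyDirichletEnergy (a : ℕ) (v : ℕ → ℂ) (b : ℝ) (u : ℝ → ℂ) : ℝ :=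
  (∑ n ∈ weilPrimeIndex b, (Λ n : ℝ) / Real.sqrt n * weilTwistIncrement (conj (v n)) u (Real.log n)) +
    ∫ t in Ioi (0 : ℝ), weilArchDensityPar a t * weilIncrement u t

/-- The **killing constant of the key** `(a, L, v)` on `[−b, b]`:
`Σ_{log n < 2b} (Λ(n)/√n)(1 + |v(n)|²) + 2∫₀^∞ (e^{(1/2−a)t} − 1)dt/(2 sinh t) + log 4π + γ − L`
(`weilMarkovConstantChar χ b` with `(charParity χ, log q, χ(n))` replaced by `(a, L, v(n))`).
[cite: Weil1952FormulesExplicites, (11) pp. 261–262; Bombieri2000Weil, Thm 2 (p. 193)] -/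
def keyMarkovConstant (a : ℕ) (L : ℝ) (v : ℕ → ℂ) (b : ℝ) : ℝ :=
  (∑ n ∈ weilPrimeIndex b, (Λ n : ℝ) / Real.sqrt n * (1 + ‖v n‖ ^ 2)) +
    2 * (∫ t in Ioi (0 : ℝ), weilKillingDensityPar a t) +
    (Real.log (4 * π) + Real.eulerMascheroniConstant - L)

/-- The **Markov window form of the key** `(a, L, v)` on `[−b, b]`: energy minus killing constant times
`‖u‖₂²` — defined for every `u : ℝ → ℂ` (window functions included); for test functions supported in the
window it is the spectral form `E_{a,L,v,N}` (`keyMarkovForm_eq_weilFinitePrimeQuadraticKey`).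
[cite: Bombieri2000Weil, Thm 2 (p. 193); Yoshida1992, §2 eq. (2.1)] -/
def keyMarkovForm (a : ℕ) (L : ℝ) (v : ℕ → ℂ) (b : ℝ) (u : ℝ → ℂ) : ℝ :=
  keyDirichletEnergy a v b u - keyMarkovConstant a L v b * ∫ x : ℝ, ‖u x‖ ^ 2

/-! ## Dictionary with the character forms -/

/-- `𝓔^χ_b = keyDirichletEnergy a_χ χ b`. [folklore] -/
theorem weilDirichletEnergyChar_eq_key (χ : DirichletCharacter ℂ q) (b : ℝ) (u : ℝ → ℂ) :
    weilDirichletEnergyChar χ b u = keyDirichletEnergy (charParity χ) (fun n ↦ χ (n : ZMod q)) b u := rfl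

/-- `M^χ_b = keyMarkovConstant a_χ (log q) χ b`. [folklore] -/
theorem weilMarkovConstantChar_eq_key (χ : DirichletCharacter ℂ q) (b : ℝ) :
    weilMarkovConstantChar χ b = keyMarkovConstant (charParity χ) (Real.log q) (fun n ↦ χ (n : ZMod q)) b :=
  rfl

/-- For `q ≠ 1` and `supp g ⊆ [−b, b]`: `Re Q_χ(g) = keyMarkovForm a_χ (log q) χ b g`.
[cite: Weil1952FormulesExplicites, (11) pp. 261–262, δ_χ = 0; Bombieri2000Weil, Thm 2 (p. 193)] -/
theorem re_weilQuadraticChar_eq_keyMarkovForm (hq : q ≠ 1) (χ : DirichletCharacter ℂ q)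
    (hg : IsWeilTest g) {b : ℝ} (hsupp : tsupport g ⊆ Icc (-b) b) :
    (weilQuadraticChar χ g).re = keyMarkovForm (charParity χ) (Real.log q) (fun n ↦ χ (n : ZMod q)) b g := by
  rw [re_weilQuadraticChar_eq_markov_of_ne_one hq χ hg hsupp]
  rfl

/-- The form is affine in the level: `keyMarkovForm a L' v b u = keyMarkovForm a L v b u + (L' − L)‖u‖₂²`. [folklore] -/
theorem keyMarkovForm_eq_add_norm (a : ℕ) (L L' : ℝ) (v : ℕ → ℂ) (b : ℝ) (u : ℝ → ℂ) :
    keyMarkovForm a L' v b u = keyMarkovForm a L v b u + (L' - L) * ∫ x : ℝ, ‖u x‖ ^ 2 := by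
  unfold keyMarkovForm keyMarkovConstant
  ring

/-! ## Affinity in the data (test functions) -/

/-- The twisted increment of a test function through the autocorrelation, for EVERY `ω ∈ ℂ`:
`D^{ω̄}_t(g) = (1 + |ω|²)‖g‖₂² − 2 Re(ω (g ⋆ g̃)(t))`. [cite: Bombieri2000Weil, Thm 2 (p. 193); Weil1952FormulesExplicites, (11) pp. 261–262] -/
theorem weilTwistIncrement_conj_of_isWeilTest (hg : IsWeilTest g) (ω : ℂ) (t : ℝ) :
    weilTwistIncrement (conj ω) g t =
      (1 + ‖ω‖ ^ 2) * (∫ x : ℝ, ‖g x‖ ^ 2) - 2 * (ω * weilConv g (weilReflect g) t).re := by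
  have h := mul_weilConv_weilReflect_add_conj_mul_neg hg ω t
  rw [weilConv_weilReflect_neg, ← map_mul, Complex.add_conj] at h
  have h' := Complex.ofReal_injective h
  linarith

/-- Affinity in the data from the twisted-increment identity (shared by test and window functions). [folklore] -/
private theorem keyMarkovForm_eq_zero_key_sub_of_twist (u : ℝ → ℂ)
    (hD : ∀ (ω : ℂ) (t : ℝ), weilTwistIncrement (conj ω) u t =
      (1 + ‖ω‖ ^ 2) * (∫ x : ℝ, ‖u x‖ ^ 2) - 2 * (ω * weilConv u (weilReflect u) t).re)
    (a : ℕ) (L : ℝ) (v : ℕ → ℂ) (b : ℝ) :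
    keyMarkovForm a L v b u = keyMarkovForm a L 0 b u -
      ∑ n ∈ weilPrimeIndex b, (Λ n : ℝ) / Real.sqrt n *
        (2 * (v n * weilConv u (weilReflect u) (Real.log n)).re) := by
  set Nrm : ℝ := ∫ x : ℝ, ‖u x‖ ^ 2 with hNrm
  have e : ∀ n : ℕ, weilTwistIncrement (conj (v n)) u (Real.log n) =
      (1 + ‖v n‖ ^ 2) * Nrm - 2 * (v n * weilConv u (weilReflect u) (Real.log n)).re :=
    fun n ↦ hD (v n) (Real.log n)
  have e0 : ∀ n : ℕ, weilTwistIncrement (conj ((0 : ℕ → ℂ) n)) u (Real.log n) = Nrm := by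
    intro n
    rw [Pi.zero_apply, hD 0 (Real.log n)]
    simp
  have hS : ∑ n ∈ weilPrimeIndex b, (Λ n : ℝ) / Real.sqrt n * weilTwistIncrement (conj (v n)) u (Real.log n) =
      (∑ n ∈ weilPrimeIndex b, (Λ n : ℝ) / Real.sqrt n * (1 + ‖v n‖ ^ 2)) * Nrm -
        ∑ n ∈ weilPrimeIndex b, (Λ n : ℝ) / Real.sqrt n *
          (2 * (v n * weilConv u (weilReflect u) (Real.log n)).re) := by
    rw [Finset.sum_mul, ← Finset.sum_sub_distrib]
    refine Finset.sum_congr rfl fun n _ ↦ ?_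
    rw [e]
    ring
  have hS0 : ∑ n ∈ weilPrimeIndex b, (Λ n : ℝ) / Real.sqrt n *
      weilTwistIncrement (conj ((0 : ℕ → ℂ) n)) u (Real.log n) =
      (∑ n ∈ weilPrimeIndex b, (Λ n : ℝ) / Real.sqrt n * (1 + ‖(0 : ℕ → ℂ) n‖ ^ 2)) * Nrm := by
    rw [Finset.sum_mul]
    refine Finset.sum_congr rfl fun n _ ↦ ?_
    rw [e0]
    simp
  unfold keyMarkovForm keyDirichletEnergy keyMarkovConstant
  rw [hS, hS0]
  ring

/-- **Affinity of the Markov key form in the data** (test functions): the `|v(n)|²` terms cancel and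
`keyMarkovForm a L v b g = keyMarkovForm a L 0 b g − Σ_{log n < 2b} (Λ(n)/√n)·2 Re(v(n) (g ⋆ g̃)(log n))`.
[cite: Weil1952FormulesExplicites, (11) pp. 261–262 (prime term linear in χ)] -/
theorem keyMarkovForm_eq_zero_key_sub_of_isWeilTest (hg : IsWeilTest g) (a : ℕ) (L : ℝ) (v : ℕ → ℂ)
    (b : ℝ) :
    keyMarkovForm a L v b g = keyMarkovForm a L 0 b g -
      ∑ n ∈ weilPrimeIndex b, (Λ n : ℝ) / Real.sqrt n *
        (2 * (v n * weilConv g (weilReflect g) (Real.log n)).re) :=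
  keyMarkovForm_eq_zero_key_sub_of_twist g (weilTwistIncrement_conj_of_isWeilTest hg) a L v b

/-! ## Affinity in the data (window functions) -/

section Window

open Summit.RiemannHypothesis.RiemannHypothesis.Theorems.WeilFormatC

variable {c : ℝ} {u : ℝ → ℂ}

/-- `x ↦ |u(x)|²` is integrable for a window function. [folklore] -/
theorem integrable_norm_sq_of_isWindowFunction (hu : IsWindowFunction c u) : Integrable fun x ↦ ‖u x‖ ^ 2 := by
  refine (hu.integrable_mul_conj hu).norm.congr (Eventually.of_forall fun x ↦ ?_)
  simp only [norm_mul, Complex.norm_conj, sq]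

/-- `x ↦ u(x+t)·conj u(x)` is integrable for a window function. [folklore] -/
theorem integrable_shift_mul_conj_of_isWindowFunction (hu : IsWindowFunction c u) (t : ℝ) :
    Integrable fun x ↦ u (x + t) * conj (u x) := by
  obtain ⟨S, hS0, hS⟩ := hu.bounded'
  have hint : Integrable fun x ↦ (Icc (-c) c).indicator (fun _ ↦ S * S) x :=
    (integrable_indicator_iff measurableSet_Icc).2 (integrableOn_const (by simp [Real.volume_Icc]))
  refine hint.mono' (((hu.measurable.comp (measurable_id.add_const t)).mul
    (Complex.continuous_conj.measurable.comp hu.measurable)).aestronglyMeasurable)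
    (Eventually.of_forall fun x ↦ ?_)
  by_cases hx : x ∈ Icc (-c) c
  · rw [indicator_of_mem hx, norm_mul, Complex.norm_conj]
    exact mul_le_mul (hS _) (hS x) (norm_nonneg _) hS0
  · rw [hu.eq_zero x hx, map_zero, mul_zero, norm_zero, indicator_of_notMem hx]

/-- The autocorrelation as a shifted integral: `(u ⋆ ũ)(t) = ∫ u(x+t) conj u(x) dx` (any `u`). [folklore] -/
theorem weilConv_weilReflect_eq_integral_shift (u : ℝ → ℂ) (t : ℝ) :
    weilConv u (weilReflect u) t = ∫ x : ℝ, u (x + t) * conj (u x) := by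
  rw [weilConv_apply, ← integral_add_right_eq_self (fun y : ℝ ↦ u y * weilReflect u (t - y)) t]
  refine integral_congr_ae (Eventually.of_forall fun x ↦ ?_)
  simp only [weilReflect]
  rw [show -(t - (x + t)) = x by ring]

/-- **The twisted increment of a WINDOW function through its autocorrelation**, for every `ω ∈ ℂ`:
`D^{ω̄}_t(u) = (1 + |ω|²)‖u‖₂² − 2 Re(ω (u ⋆ ũ)(t))` (pointwise twisted polarisation, integrated with the
window-function integrability lemmas). [cite: Bombieri2000Weil, Thm 2 (p. 193)] -/
theorem weilTwistIncrement_conj_of_isWindowFunction (hu : IsWindowFunction c u) (ω : ℂ) (t : ℝ) :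
    weilTwistIncrement (conj ω) u t =
      (1 + ‖ω‖ ^ 2) * (∫ x : ℝ, ‖u x‖ ^ 2) - 2 * (ω * weilConv u (weilReflect u) t).re := by
  have h1 : Integrable fun x ↦ ‖u (x + t)‖ ^ 2 := (integrable_norm_sq_of_isWindowFunction hu).comp_add_right t
  have h2 : Integrable fun x ↦ ‖ω‖ ^ 2 * ‖u x‖ ^ 2 := (integrable_norm_sq_of_isWindowFunction hu).const_mul _
  have hI : Integrable fun x ↦ ω * (u (x + t) * conj (u x)) :=
    (integrable_shift_mul_conj_of_isWindowFunction hu t).const_mul ω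
  have h3 : Integrable fun x ↦ 2 * (ω * (u (x + t) * conj (u x))).re := hI.re.const_mul 2
  have e : ∀ x, ‖u (x + t) - conj ω * u x‖ ^ 2 =
      ‖u (x + t)‖ ^ 2 + ‖ω‖ ^ 2 * ‖u x‖ ^ 2 - 2 * (ω * (u (x + t) * conj (u x))).re := by
    intro x
    have hw : conj (conj ω * u x) = ω * conj (u x) := by rw [map_mul, Complex.conj_conj]
    rw [← Complex.normSq_eq_norm_sq, Complex.normSq_sub, hw, Complex.normSq_eq_norm_sq,
      Complex.normSq_eq_norm_sq, norm_mul, Complex.norm_conj, mul_pow,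
      show u (x + t) * (ω * conj (u x)) = ω * (u (x + t) * conj (u x)) by ring]
  have h4 : ∫ x : ℝ, ‖u (x + t)‖ ^ 2 = ∫ x : ℝ, ‖u x‖ ^ 2 :=
    integral_add_right_eq_self (fun x : ℝ ↦ ‖u x‖ ^ 2) t
  have h5 : ∫ x : ℝ, (ω * (u (x + t) * conj (u x))).re = (ω * weilConv u (weilReflect u) t).re := by
    have h := Complex.reCLM.integral_comp_comm hI
    simp only [Complex.reCLM_apply] at h
    rw [h, integral_const_mul, weilConv_weilReflect_eq_integral_shift]
  have h12 : Integrable fun x ↦ ‖u (x + t)‖ ^ 2 + ‖ω‖ ^ 2 * ‖u x‖ ^ 2 := h1.add h2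
  unfold weilTwistIncrement
  simp_rw [e]
  rw [integral_sub h12 h3, integral_add h1 h2, integral_const_mul, integral_const_mul, h4, h5]
  ring

/-- **Affinity of the Markov key form in the data on WINDOW functions** (trigonometric sections included):
`keyMarkovForm a L v b u = keyMarkovForm a L 0 b u − Σ_{log n < 2b} (Λ(n)/√n)·2 Re(v(n) (u ⋆ ũ)(log n))`.
[cite: Weil1952FormulesExplicites, (11) pp. 261–262 (prime term linear in χ)] -/
theorem keyMarkovForm_eq_zero_key_sub_of_isWindowFunction (hu : IsWindowFunction c u) (a : ℕ) (L : ℝ)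
    (v : ℕ → ℂ) (b : ℝ) :
    keyMarkovForm a L v b u = keyMarkovForm a L 0 b u -
      ∑ n ∈ weilPrimeIndex b, (Λ n : ℝ) / Real.sqrt n *
        (2 * (v n * weilConv u (weilReflect u) (Real.log n)).re) :=
  keyMarkovForm_eq_zero_key_sub_of_twist u (weilTwistIncrement_conj_of_isWindowFunction hu) a L v b

end Window

/-! ## The window index and the visible integers -/

/-- `weilPrimeIndex t ⊆ {0, …, N}` when `e^{2t} ≤ N + 1`. [folklore] -/
theorem weilPrimeIndex_subset_range {t : ℝ} {N : ℕ} (hN : Real.exp (2 * t) ≤ (N : ℝ) + 1) :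
    weilPrimeIndex t ⊆ Finset.range (N + 1) := by
  intro n hn
  have hlog : Real.log n < 2 * t := mem_weilPrimeIndex.1 hn
  rw [Finset.mem_range, Nat.lt_succ_iff]
  by_contra h
  push Not at h
  have h1 : (N : ℝ) + 1 ≤ n := by exact_mod_cast h
  have hpos : (0 : ℝ) < n := by linarith [Nat.cast_nonneg (α := ℝ) N]
  have h2 : 2 * t ≤ Real.log n := (Real.le_log_iff_exp_le hpos).2 (hN.trans h1)
  linarith

/-- For `supp g ⊆ [−t, t]` and `e^{2t} ≤ N + 1` the spike sums over `n ≤ N` and over `log n < 2t` agree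
(the autocorrelation vanishes at `|x| ≥ 2t`). [cite: Yoshida1992, §2 (support of g ⋆ g̃)] -/
theorem sum_range_spikes_eq_sum_weilPrimeIndex (hg : IsWeilTest g) {t : ℝ}
    (hsupp : tsupport g ⊆ Icc (-t) t) {N : ℕ} (hN : Real.exp (2 * t) ≤ (N : ℝ) + 1) (c : ℕ → ℂ) :
    ∑ n ∈ Finset.range (N + 1), (Λ n : ℝ) / Real.sqrt n *
        (2 * (c n * weilConv g (weilReflect g) (Real.log n)).re) =
      ∑ n ∈ weilPrimeIndex t, (Λ n : ℝ) / Real.sqrt n *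
        (2 * (c n * weilConv g (weilReflect g) (Real.log n)).re) := by
  symm
  refine Finset.sum_subset (weilPrimeIndex_subset_range hN) fun n _ hnot ↦ ?_
  have hge : 2 * t ≤ Real.log n := by
    by_contra h
    push Not at h
    exact hnot (mem_weilPrimeIndex.2 h)
  rw [weilConv_weilReflect_eq_zero_of_le_abs hg hsupp (hge.trans (le_abs_self _)), mul_zero,
    Complex.zero_re, mul_zero, mul_zero]

/-! ## Anchor characters of each parity -/

/-- The quadratic character mod `4` with complex values (Mathlib's `ZMod.χ₄` composed with `ℤ → ℂ`). -/
def oddCharFour : DirichletCharacter ℂ 4 := ZMod.χ₄.ringHomComp (Int.castRingHom ℂ)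

/-- The trivial character mod `2` is even. [folklore] -/
theorem charParity_one_mod_two : charParity (1 : DirichletCharacter ℂ 2) = 0 := by
  apply charParity_of_even
  show (1 : DirichletCharacter ℂ 2) (-1) = 1
  have h : (-1 : ZMod 2) = 1 := by decide
  rw [h, map_one]

/-- `χ₄` is odd. [folklore] -/
theorem charParity_oddCharFour : charParity oddCharFour = 1 := by
  haveI : NeZero (4 : ℕ) := ⟨by norm_num⟩
  apply charParity_of_odd
  show oddCharFour (-1) = -1
  have h : ZMod.χ₄ (-1 : ZMod 4) = -1 := by decide
  rw [oddCharFour, MulChar.ringHomComp_apply, h]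
  simp

/-- There is a Dirichlet character of each parity `a ≤ 1` to a modulus `q ≠ 1`. [folklore] -/
theorem exists_char_of_parity {a : ℕ} (ha : a ≤ 1) :
    ∃ q : ℕ, q ≠ 1 ∧ ∃ χ : DirichletCharacter ℂ q, charParity χ = a := by
  interval_cases a
  · exact ⟨2, by norm_num, 1, charParity_one_mod_two⟩
  · exact ⟨4, by norm_num, oddCharFour, charParity_oddCharFour⟩

/-! ## The dictionary: Markov key form = spectral key form on test functions -/

/-- **THE KEY FORMS ARE MARKOV WINDOW FORMS.**  For a test function `g` with `supp g ⊆ [−t, t]`,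
`e^{2t} ≤ N + 1`, parity `a ≤ 1` and every level `L` and data `v`:
`keyMarkovForm a L v t g = E_{a,L,v,N}(g)`.  (Anchor at a character of parity `a` — where both sides are
`Re Q_χ(g)` by the tree — and transport by affinity in `v` and in `L`.)
[cite: Weil1952FormulesExplicites, (11) pp. 261–262; Bombieri2000Weil, Thm 2 (p. 193); Yoshida1992, §2 eq. (2.1)] -/
theorem keyMarkovForm_eq_weilFinitePrimeQuadraticKey (hg : IsWeilTest g) {t : ℝ}
    (hsupp : tsupport g ⊆ Icc (-t) t) {N : ℕ} (hN : Real.exp (2 * t) ≤ (N : ℝ) + 1)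
    {a : ℕ} (ha : a ≤ 1) (L : ℝ) (v : ℕ → ℂ) :
    keyMarkovForm a L v t g = weilFinitePrimeQuadraticKey a L v N g := by
  obtain ⟨q, hq, χ, hχ⟩ := exists_char_of_parity ha
  subst hχ
  -- the anchor: both sides are Re Q_χ(g) at (log q, χ)
  have hA : keyMarkovForm (charParity χ) (Real.log q) (fun n ↦ χ (n : ZMod q)) t g =
      weilFinitePrimeQuadraticKey (charParity χ) (Real.log q) (fun n ↦ χ (n : ZMod q)) N g := by
    rw [← re_weilQuadraticChar_eq_keyMarkovForm hq χ hg hsupp, ← weilFinitePrimeQuadraticChar_eq_key]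
    exact weilQuadraticChar_re_eq_weilFinitePrimeQuadraticChar hq χ hg hN hsupp
  -- affinity in v and L on both sides
  have hK1 := weilFinitePrimeQuadraticKey_eq_zero_key_sub_spikes hg (charParity χ) L v N
  have hK2 := weilFinitePrimeQuadraticKey_eq_zero_key_sub_spikes hg (charParity χ) (Real.log q)
    (fun n ↦ χ (n : ZMod q)) N
  have hK3 := weilFinitePrimeQuadraticKey_eq_add_norm hg (charParity χ) (Real.log q) L 0 N
  have hM1 := keyMarkovForm_eq_zero_key_sub_of_isWeilTest hg (charParity χ) L v t
  have hM2 := keyMarkovForm_eq_zero_key_sub_of_isWeilTest hg (charParity χ) (Real.log q)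
    (fun n ↦ χ (n : ZMod q)) t
  have hM3 := keyMarkovForm_eq_add_norm (charParity χ) (Real.log q) L 0 t g
  have hI1 := sum_range_spikes_eq_sum_weilPrimeIndex hg hsupp hN v
  have hI2 := sum_range_spikes_eq_sum_weilPrimeIndex hg hsupp hN (fun n ↦ χ (n : ZMod q))
  have hNrm : weilNorm2Sq g = ∫ x : ℝ, ‖g x‖ ^ 2 := rfl
  rw [hNrm] at hK3
  linarith

/-- In particular, for a character mod `q ≠ 1` and ANY level `L`:
`keyMarkovForm a_χ L χ t g = E_{a_χ, L, χ, N}(g)` on the window (the `L = log q` case is `Re Q_χ(g)`). [folklore] -/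
theorem keyMarkovForm_char_eq_key (χ : DirichletCharacter ℂ q) (hg : IsWeilTest g) {t : ℝ}
    (hsupp : tsupport g ⊆ Icc (-t) t) {N : ℕ} (hN : Real.exp (2 * t) ≤ (N : ℝ) + 1) (L : ℝ) :
    keyMarkovForm (charParity χ) L (fun n ↦ χ (n : ZMod q)) t g =
      weilFinitePrimeQuadraticKey (charParity χ) L (fun n ↦ χ (n : ZMod q)) N g :=
  keyMarkovForm_eq_weilFinitePrimeQuadraticKey hg hsupp hN (charParity_le_one χ) L _

/-- **Window positivity of a key, position-space form**: `WeilPositivityOnKey a L v N` (`a ≤ 1`) iff the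
Markov key form is `≥ 0` at every test function on `[−log(N+1)/2, log(N+1)/2]`. [folklore] -/
theorem weilPositivityOnKey_iff_keyMarkovForm_nonneg {a : ℕ} (ha : a ≤ 1) (L : ℝ) (v : ℕ → ℂ) (N : ℕ) :
    WeilPositivityOnKey a L v N ↔
      ∀ g : ℝ → ℂ, IsWeilTest g →
        tsupport g ⊆ Icc (-(Real.log ((N : ℝ) + 1) / 2)) (Real.log ((N : ℝ) + 1) / 2) →
        0 ≤ keyMarkovForm a L v (Real.log ((N : ℝ) + 1) / 2) g := by
  have hN : Real.exp (2 * (Real.log ((N : ℝ) + 1) / 2)) ≤ (N : ℝ) + 1 := by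
    rw [mul_div_cancel₀ _ (two_ne_zero), Real.exp_log (by positivity)]
  constructor
  · intro h g hg hsupp
    rw [keyMarkovForm_eq_weilFinitePrimeQuadraticKey hg hsupp hN ha L v]
    exact h g hg hsupp
  · intro h g hg hsupp
    rw [← keyMarkovForm_eq_weilFinitePrimeQuadraticKey hg hsupp hN ha L v]
    exact h g hg hsupp

end Summit.Ventures.WeilGRH
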